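import Summits.BirchSwinnertonDyer.Rank1Residual.Additive.X3ThreeLineDatum
import Summits.BirchSwinnertonDyer.Rank1Residual.X2.CellAGVParCertificatesN9A
import Mathlib.Tactic.Simproc.Factors
import HarnessLib

/-!
# X3♯(G-ord, `e = 2`) at `p = 3`: kernel records of the per-pair LINE DATUM `X3LineDatumThree W` for the
# Case-1 members of the B-X3G booking list — part F of 16 (cell `bsd-addord`, seat
# `bsd-addord-twist`, strategy = twist transport)

HONEST FRAMING (cell `bsd-addord`, `run/shared/lean/pub/bsd-addord/README.md` §4): the programme's
target of record is the full Birch–Swinnerton-Dyer formula for every `E/ℚ` of analytic rank `≤ 1`.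
DATA-RECORDS module: theorems only (no definition, no named fact, no `sorry`); it BOOKS NOTHING and
moves no mark — booking is the planner's act (TARGET.md v5.5 §8 protocol B-X3G, (iv)).

## What is recorded

For each isogeny class `(N, class, 3)` of the booking list `HOME/bsd-addord-twist-booking-members.tsv`
(kit job j242057; the r_an = 0, non-CM, non-degenerate branch-parity classes of cell (G-ord, `e = 2`) at
`p = 3` in census v2, planner keys `HOME/planner/bx3g/`), the CASE-1 MEMBER `W = [a₁, a₂, a₃, a₄, a₆]`
(Cremona's globally minimal model; the first member in Cremona order carrying the EVEN rational `3`-line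
as a SUB-line) and the theorem `X3LineDatumThree W` — SOME rational `3`-line `Φ₀ ≤ W[3]` which is even,
has non-trivial `Γ_ℚ`-action and `χ_{−3}`-twist ramified at `3` — proved by
`x3LineDatumThree_of_cert_of_delta` from the certificate `(x₀, s, D, q)`: `Ψ₃(x₀) = 0`, `D` squarefree,
`s ≠ 0`, `D·s² = Ψ₂Sq(x₀)`, `0 < D`, `D ≠ 1`, `3 ∤ D` (`norm_num` identities, one prime-factor-list
computation with X2a's helper `squarefree_of_nodup_primeFactorsList_natAbs`, `decide`s). This is the per-pair line-datum input of
`ClassX3Gord.{{missingLowerBoundAt,bsdp}}_three_rankZero_of_facts_of_nonAnomalous`; the class binders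
(`ClassX3Gord W 3`, `¬ HasCM`, `analyticRank = 0`, `ReductionNonAnomalous W 3`) are data of record
(Cremona / the planner's two-engine census), NOT kernel statements here; the other members of each class
are reached by Cassels (`N10.bsdp_of_isIsogenous_of_bsdp`, binder `bsdRHS_eq_of_isIsogenous`). The
docstring of each record names the class, the anomalous bit of the twist `V = W ⊗ χ_{−3}` and `D`
(`φ = χ_D`). Records sorted by conductor.

References: [GreenbergVatsal2000] §2 p. 28 (the line `Φ`); lane file
`HOME/bsd-addord-twist-booking-members.tsv`; `Additive/X3ThreeLineDatum.lean`.
-/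

set_option autoImplicit false

open WeierstrassCurve Polynomial Literature.NumberTheory.EllipticCurves
  Literature.NumberTheory.EllipticCurves.Rank1Residual

namespace Summit.BirchSwinnertonDyer.Rank1Residual.Additive.X3ThreeLineDatumRecords

/-- `123210dj3` = `[1,-1,1,-64993532,201691786799]` (class `123210dj`, (G-ord, `e = 2`) at `3`; twist `13690b3`, `a₃(V) = -2` — ANOMALOUS (outside the end state as typed); even line
`φ = χ_{37}`): `x₀ = 4690`, `D = 37`, `s = 1369`, `Ψ₂Sq(x₀) = 69343957` ⇒ `X3LineDatumThree W`. [folklore] -/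
theorem x3LineDatumThree_123210dj3 : X3LineDatumThree (⟨1, -1, 1, -64993532, 201691786799⟩ : WeierstrassCurve ℚ) :=
  x3LineDatumThree_of_cert_of_delta _ (by norm_num [Δ, b₂, b₄, b₆, b₈]) 4690 1369 37
    (by simp only [Ψ₃, eval_add, eval_mul, eval_pow, eval_C, eval_X, eval_ofNat]; norm_num [b₂, b₄, b₆, b₈])
    (X2.CellACertN9.squarefree_of_nodup_primeFactorsList_natAbs (by norm_num) (by simp [Nat.primeFactorsList_ofNat])) (by norm_num)
    (by rw [KernelDisc.eval_Ψ₂Sq]; norm_num [b₂, b₄, b₆]) (by decide) (by decide) (by decide)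

/-- `123840bj2` = `[0,0,0,-20748,6041072]` (class `123840bj`, (G-ord, `e = 2`) at `3`; twist `13760f2`, `a₃(V) = 2`, non-anomalous; even line
`φ = χ_{2}`): `x₀ = 6`, `D = 2`, `s = 3440`, `Ψ₂Sq(x₀) = 23667200` ⇒ `X3LineDatumThree W`. [folklore] -/
theorem x3LineDatumThree_123840bj2 : X3LineDatumThree (⟨0, 0, 0, -20748, 6041072⟩ : WeierstrassCurve ℚ) :=
  x3LineDatumThree_of_cert_of_delta _ (by norm_num [Δ, b₂, b₄, b₆, b₈]) 6 3440 2
    (by simp only [Ψ₃, eval_add, eval_mul, eval_pow, eval_C, eval_X, eval_ofNat]; norm_num [b₂, b₄, b₆, b₈])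
    Int.prime_two.squarefree (by norm_num)
    (by rw [KernelDisc.eval_Ψ₂Sq]; norm_num [b₂, b₄, b₆]) (by decide) (by decide) (by decide)

/-- `124992dh2` = `[0,0,0,20724,5902832]` (class `124992dh`, (G-ord, `e = 2`) at `3`; twist `13888k2`, `a₃(V) = -1`, non-anomalous; even line
`φ = χ_{2}`): `x₀ = 6`, `D = 2`, `s = 3472`, `Ψ₂Sq(x₀) = 24109568` ⇒ `X3LineDatumThree W`. [folklore] -/
theorem x3LineDatumThree_124992dh2 : X3LineDatumThree (⟨0, 0, 0, 20724, 5902832⟩ : WeierstrassCurve ℚ) :=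
  x3LineDatumThree_of_cert_of_delta _ (by norm_num [Δ, b₂, b₄, b₆, b₈]) 6 3472 2
    (by simp only [Ψ₃, eval_add, eval_mul, eval_pow, eval_C, eval_X, eval_ofNat]; norm_num [b₂, b₄, b₆, b₈])
    Int.prime_two.squarefree (by norm_num)
    (by rw [KernelDisc.eval_Ψ₂Sq]; norm_num [b₂, b₄, b₆]) (by decide) (by decide) (by decide)

/-- `125100n2` = `[0,0,0,20175,2109125]` (class `125100n`, (G-ord, `e = 2`) at `3`; twist `13900c2`, `a₃(V) = -1`, non-anomalous; even line
`φ = χ_{5}`): `x₀ = 15`, `D = 5`, `s = 1390`, `Ψ₂Sq(x₀) = 9660500` ⇒ `X3LineDatumThree W`. [folklore] -/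
theorem x3LineDatumThree_125100n2 : X3LineDatumThree (⟨0, 0, 0, 20175, 2109125⟩ : WeierstrassCurve ℚ) :=
  x3LineDatumThree_of_cert_of_delta _ (by norm_num [Δ, b₂, b₄, b₆, b₈]) 15 1390 5
    (by simp only [Ψ₃, eval_add, eval_mul, eval_pow, eval_C, eval_X, eval_ofNat]; norm_num [b₂, b₄, b₆, b₈])
    (X2.CellACertN9.squarefree_of_nodup_primeFactorsList_natAbs (by norm_num) (by simp [Nat.primeFactorsList_ofNat])) (by norm_num)
    (by rw [KernelDisc.eval_Ψ₂Sq]; norm_num [b₂, b₄, b₆]) (by decide) (by decide) (by decide)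

/-- `126450f2` = `[1,-1,0,4445208,-1208672384]` (class `126450f`, (G-ord, `e = 2`) at `3`; twist `14050j2`, `a₃(V) = 2`, non-anomalous; even line
`φ = χ_{5}`): `x₀ = 1084`, `D = 5`, `s = 62500`, `Ψ₂Sq(x₀) = 19531250000` ⇒ `X3LineDatumThree W`. [folklore] -/
theorem x3LineDatumThree_126450f2 : X3LineDatumThree (⟨1, -1, 0, 4445208, -1208672384⟩ : WeierstrassCurve ℚ) :=
  x3LineDatumThree_of_cert_of_delta _ (by norm_num [Δ, b₂, b₄, b₆, b₈]) 1084 62500 5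
    (by simp only [Ψ₃, eval_add, eval_mul, eval_pow, eval_C, eval_X, eval_ofNat]; norm_num [b₂, b₄, b₆, b₈])
    (X2.CellACertN9.squarefree_of_nodup_primeFactorsList_natAbs (by norm_num) (by simp [Nat.primeFactorsList_ofNat])) (by norm_num)
    (by rw [KernelDisc.eval_Ψ₂Sq]; norm_num [b₂, b₄, b₆]) (by decide) (by decide) (by decide)

/-- `128700u2` = `[0,0,0,535200,-453215500]` (class `128700u`, (G-ord, `e = 2`) at `3`; twist `14300c2`, `a₃(V) = 2`, non-anomalous; even line
`φ = χ_{5}`): `x₀ = 960`, `D = 5`, `s = 27500`, `Ψ₂Sq(x₀) = 3781250000` ⇒ `X3LineDatumThree W`. [folklore] -/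
theorem x3LineDatumThree_128700u2 : X3LineDatumThree (⟨0, 0, 0, 535200, -453215500⟩ : WeierstrassCurve ℚ) :=
  x3LineDatumThree_of_cert_of_delta _ (by norm_num [Δ, b₂, b₄, b₆, b₈]) 960 27500 5
    (by simp only [Ψ₃, eval_add, eval_mul, eval_pow, eval_C, eval_X, eval_ofNat]; norm_num [b₂, b₄, b₆, b₈])
    (X2.CellACertN9.squarefree_of_nodup_primeFactorsList_natAbs (by norm_num) (by simp [Nat.primeFactorsList_ofNat])) (by norm_num)
    (by rw [KernelDisc.eval_Ψ₂Sq]; norm_num [b₂, b₄, b₆]) (by decide) (by decide) (by decide)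

/-- `129150o3` = `[1,-1,0,-17810667,-17773963259]` (class `129150o`, (G-ord, `e = 2`) at `3`; twist `14350p3`, `a₃(V) = 2`, non-anomalous; even line
`φ = χ_{5}`): `x₀ = 6934`, `D = 5`, `s = 392000`, `Ψ₂Sq(x₀) = 768320000000` ⇒ `X3LineDatumThree W`. [folklore] -/
theorem x3LineDatumThree_129150o3 : X3LineDatumThree (⟨1, -1, 0, -17810667, -17773963259⟩ : WeierstrassCurve ℚ) :=
  x3LineDatumThree_of_cert_of_delta _ (by norm_num [Δ, b₂, b₄, b₆, b₈]) 6934 392000 5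
    (by simp only [Ψ₃, eval_add, eval_mul, eval_pow, eval_C, eval_X, eval_ofNat]; norm_num [b₂, b₄, b₆, b₈])
    (X2.CellACertN9.squarefree_of_nodup_primeFactorsList_natAbs (by norm_num) (by simp [Nat.primeFactorsList_ofNat])) (by norm_num)
    (by rw [KernelDisc.eval_Ψ₂Sq]; norm_num [b₂, b₄, b₆]) (by decide) (by decide) (by decide)

/-- `129150p2` = `[1,-1,0,-525267,146617141]` (class `129150p`, (G-ord, `e = 2`) at `3`; twist `14350o2`, `a₃(V) = -1`, non-anomalous; even line
`φ = χ_{5}`): `x₀ = 454`, `D = 5`, `s = 1120`, `Ψ₂Sq(x₀) = 6272000` ⇒ `X3LineDatumThree W`. [folklore] -/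
theorem x3LineDatumThree_129150p2 : X3LineDatumThree (⟨1, -1, 0, -525267, 146617141⟩ : WeierstrassCurve ℚ) :=
  x3LineDatumThree_of_cert_of_delta _ (by norm_num [Δ, b₂, b₄, b₆, b₈]) 454 1120 5
    (by simp only [Ψ₃, eval_add, eval_mul, eval_pow, eval_C, eval_X, eval_ofNat]; norm_num [b₂, b₄, b₆, b₈])
    (X2.CellACertN9.squarefree_of_nodup_primeFactorsList_natAbs (by norm_num) (by simp [Nat.primeFactorsList_ofNat])) (by norm_num)
    (by rw [KernelDisc.eval_Ψ₂Sq]; norm_num [b₂, b₄, b₆]) (by decide) (by decide) (by decide)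

/-- `130050bx2` = `[1,-1,1,19506145,18364197147]` (class `130050bx`, (G-ord, `e = 2`) at `3`; twist `14450h2`, `a₃(V) = -1`, non-anomalous; even line
`φ = χ_{5}`): `x₀ = 1084`, `D = 5`, `s = 180625`, `Ψ₂Sq(x₀) = 163126953125` ⇒ `X3LineDatumThree W`. [folklore] -/
theorem x3LineDatumThree_130050bx2 : X3LineDatumThree (⟨1, -1, 1, 19506145, 18364197147⟩ : WeierstrassCurve ℚ) :=
  x3LineDatumThree_of_cert_of_delta _ (by norm_num [Δ, b₂, b₄, b₆, b₈]) 1084 180625 5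
    (by simp only [Ψ₃, eval_add, eval_mul, eval_pow, eval_C, eval_X, eval_ofNat]; norm_num [b₂, b₄, b₆, b₈])
    (X2.CellACertN9.squarefree_of_nodup_primeFactorsList_natAbs (by norm_num) (by simp [Nat.primeFactorsList_ofNat])) (by norm_num)
    (by rw [KernelDisc.eval_Ψ₂Sq]; norm_num [b₂, b₄, b₆]) (by decide) (by decide) (by decide)

/-- `130050ft2` = `[1,-1,0,57168,2370816]` (class `130050ft`, (G-ord, `e = 2`) at `3`; twist `14450t2`, `a₃(V) = 1` — ANOMALOUS (outside the end state as typed); even line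
`φ = χ_{85}`): `x₀ = 64`, `D = 85`, `s = 544`, `Ψ₂Sq(x₀) = 25154560` ⇒ `X3LineDatumThree W`. [folklore] -/
theorem x3LineDatumThree_130050ft2 : X3LineDatumThree (⟨1, -1, 0, 57168, 2370816⟩ : WeierstrassCurve ℚ) :=
  x3LineDatumThree_of_cert_of_delta _ (by norm_num [Δ, b₂, b₄, b₆, b₈]) 64 544 85
    (by simp only [Ψ₃, eval_add, eval_mul, eval_pow, eval_C, eval_X, eval_ofNat]; norm_num [b₂, b₄, b₆, b₈])
    (X2.CellACertN9.squarefree_of_nodup_primeFactorsList_natAbs (by norm_num) (by simp [Nat.primeFactorsList_ofNat])) (by norm_num)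
    (by rw [KernelDisc.eval_Ψ₂Sq]; norm_num [b₂, b₄, b₆]) (by decide) (by decide) (by decide)

/-- `130050fy3` = `[1,-1,0,-271058067,337936060341]` (class `130050fy`, (G-ord, `e = 2`) at `3`; twist `14450w3`, `a₃(V) = -2` — ANOMALOUS (outside the end state as typed); even line
`φ = χ_{85}`): `x₀ = 23014`, `D = 85`, `s = 544000`, `Ψ₂Sq(x₀) = 25154560000000` ⇒ `X3LineDatumThree W`. [folklore] -/
theorem x3LineDatumThree_130050fy3 : X3LineDatumThree (⟨1, -1, 0, -271058067, 337936060341⟩ : WeierstrassCurve ℚ) :=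
  x3LineDatumThree_of_cert_of_delta _ (by norm_num [Δ, b₂, b₄, b₆, b₈]) 23014 544000 85
    (by simp only [Ψ₃, eval_add, eval_mul, eval_pow, eval_C, eval_X, eval_ofNat]; norm_num [b₂, b₄, b₆, b₈])
    (X2.CellACertN9.squarefree_of_nodup_primeFactorsList_natAbs (by norm_num) (by simp [Nat.primeFactorsList_ofNat])) (by norm_num)
    (by rw [KernelDisc.eval_Ψ₂Sq]; norm_num [b₂, b₄, b₆]) (by decide) (by decide) (by decide)

/-- `130050g2` = `[1,-1,1,-326480,71884347]` (class `130050g`, (G-ord, `e = 2`) at `3`; twist `14450l2`, `a₃(V) = -1`, non-anomalous; even line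
`φ = χ_{17}`): `x₀ = 319`, `D = 17`, `s = 170`, `Ψ₂Sq(x₀) = 491300` ⇒ `X3LineDatumThree W`. [folklore] -/
theorem x3LineDatumThree_130050g2 : X3LineDatumThree (⟨1, -1, 1, -326480, 71884347⟩ : WeierstrassCurve ℚ) :=
  x3LineDatumThree_of_cert_of_delta _ (by norm_num [Δ, b₂, b₄, b₆, b₈]) 319 170 17
    (by simp only [Ψ₃, eval_add, eval_mul, eval_pow, eval_C, eval_X, eval_ofNat]; norm_num [b₂, b₄, b₆, b₈])
    (X2.CellACertN9.squarefree_of_nodup_primeFactorsList_natAbs (by norm_num) (by simp [Nat.primeFactorsList_ofNat])) (by norm_num)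
    (by rw [KernelDisc.eval_Ψ₂Sq]; norm_num [b₂, b₄, b₆]) (by decide) (by decide) (by decide)

/-- `130806h2` = `[1,-1,1,307210,-84260419]` (class `130806h`, (G-ord, `e = 2`) at `3`; twist `14534b2`, `a₃(V) = 1` — ANOMALOUS (outside the end state as typed); even line
`φ = χ_{13}`): `x₀ = 478`, `D = 13`, `s = 7267`, `Ψ₂Sq(x₀) = 686520757` ⇒ `X3LineDatumThree W`. [folklore] -/
theorem x3LineDatumThree_130806h2 : X3LineDatumThree (⟨1, -1, 1, 307210, -84260419⟩ : WeierstrassCurve ℚ) :=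
  x3LineDatumThree_of_cert_of_delta _ (by norm_num [Δ, b₂, b₄, b₆, b₈]) 478 7267 13
    (by simp only [Ψ₃, eval_add, eval_mul, eval_pow, eval_C, eval_X, eval_ofNat]; norm_num [b₂, b₄, b₆, b₈])
    (X2.CellACertN9.squarefree_of_nodup_primeFactorsList_natAbs (by norm_num) (by simp [Nat.primeFactorsList_ofNat])) (by norm_num)
    (by rw [KernelDisc.eval_Ψ₂Sq]; norm_num [b₂, b₄, b₆]) (by decide) (by decide) (by decide)

/-- `131904be2` = `[0,0,0,-5664,78536]` (class `131904be`, (G-ord, `e = 2`) at `3`; twist `14656h2`, `a₃(V) = -1`, non-anomalous; even line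
`φ = χ_{2}`): `x₀ = 96`, `D = 2`, `s = 916`, `Ψ₂Sq(x₀) = 1678112` ⇒ `X3LineDatumThree W`. [folklore] -/
theorem x3LineDatumThree_131904be2 : X3LineDatumThree (⟨0, 0, 0, -5664, 78536⟩ : WeierstrassCurve ℚ) :=
  x3LineDatumThree_of_cert_of_delta _ (by norm_num [Δ, b₂, b₄, b₆, b₈]) 96 916 2
    (by simp only [Ψ₃, eval_add, eval_mul, eval_pow, eval_C, eval_X, eval_ofNat]; norm_num [b₂, b₄, b₆, b₈])
    Int.prime_two.squarefree (by norm_num)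
    (by rw [KernelDisc.eval_Ψ₂Sq]; norm_num [b₂, b₄, b₆]) (by decide) (by decide) (by decide)

/-- `134550bt2` = `[1,-1,1,-214250,1020520347]` (class `134550bt`, (G-ord, `e = 2`) at `3`; twist `14950b2`, `a₃(V) = -1`, non-anomalous; even line
`φ = χ_{5}`): `x₀ = 4`, `D = 5`, `s = 28561`, `Ψ₂Sq(x₀) = 4078653605` ⇒ `X3LineDatumThree W`. [folklore] -/
theorem x3LineDatumThree_134550bt2 : X3LineDatumThree (⟨1, -1, 1, -214250, 1020520347⟩ : WeierstrassCurve ℚ) :=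
  x3LineDatumThree_of_cert_of_delta _ (by norm_num [Δ, b₂, b₄, b₆, b₈]) 4 28561 5
    (by simp only [Ψ₃, eval_add, eval_mul, eval_pow, eval_C, eval_X, eval_ofNat]; norm_num [b₂, b₄, b₆, b₈])
    (X2.CellACertN9.squarefree_of_nodup_primeFactorsList_natAbs (by norm_num) (by simp [Nat.primeFactorsList_ofNat])) (by norm_num)
    (by rw [KernelDisc.eval_Ψ₂Sq]; norm_num [b₂, b₄, b₆]) (by decide) (by decide) (by decide)

/-- `134550dk2` = `[1,-1,0,-3942,-6404]` (class `134550dk`, (G-ord, `e = 2`) at `3`; twist `14950z2`, `a₃(V) = -1`, non-anomalous; even line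
`φ = χ_{5}`): `x₀ = 94`, `D = 5`, `s = 598`, `Ψ₂Sq(x₀) = 1788020` ⇒ `X3LineDatumThree W`. [folklore] -/
theorem x3LineDatumThree_134550dk2 : X3LineDatumThree (⟨1, -1, 0, -3942, -6404⟩ : WeierstrassCurve ℚ) :=
  x3LineDatumThree_of_cert_of_delta _ (by norm_num [Δ, b₂, b₄, b₆, b₈]) 94 598 5
    (by simp only [Ψ₃, eval_add, eval_mul, eval_pow, eval_C, eval_X, eval_ofNat]; norm_num [b₂, b₄, b₆, b₈])
    (X2.CellACertN9.squarefree_of_nodup_primeFactorsList_natAbs (by norm_num) (by simp [Nat.primeFactorsList_ofNat])) (by norm_num)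
    (by rw [KernelDisc.eval_Ψ₂Sq]; norm_num [b₂, b₄, b₆]) (by decide) (by decide) (by decide)

/-- `134550dt2` = `[1,-1,0,-124317,7718341]` (class `134550dt`, (G-ord, `e = 2`) at `3`; twist `14950x2`, `a₃(V) = -1`, non-anomalous; even line
`φ = χ_{5}`): `x₀ = 454`, `D = 5`, `s = 5980`, `Ψ₂Sq(x₀) = 178802000` ⇒ `X3LineDatumThree W`. [folklore] -/
theorem x3LineDatumThree_134550dt2 : X3LineDatumThree (⟨1, -1, 0, -124317, 7718341⟩ : WeierstrassCurve ℚ) :=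
  x3LineDatumThree_of_cert_of_delta _ (by norm_num [Δ, b₂, b₄, b₆, b₈]) 454 5980 5
    (by simp only [Ψ₃, eval_add, eval_mul, eval_pow, eval_C, eval_X, eval_ofNat]; norm_num [b₂, b₄, b₆, b₈])
    (X2.CellACertN9.squarefree_of_nodup_primeFactorsList_natAbs (by norm_num) (by simp [Nat.primeFactorsList_ofNat])) (by norm_num)
    (by rw [KernelDisc.eval_Ψ₂Sq]; norm_num [b₂, b₄, b₆]) (by decide) (by decide) (by decide)

/-- `134550dw2` = `[1,-1,0,-4737042,-2644851884]` (class `134550dw`, (G-ord, `e = 2`) at `3`; twist `14950y2`, `a₃(V) = -1`, non-anomalous; even line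
`φ = χ_{5}`): `x₀ = 3604`, `D = 5`, `s = 147200`, `Ψ₂Sq(x₀) = 108339200000` ⇒ `X3LineDatumThree W`. [folklore] -/
theorem x3LineDatumThree_134550dw2 : X3LineDatumThree (⟨1, -1, 0, -4737042, -2644851884⟩ : WeierstrassCurve ℚ) :=
  x3LineDatumThree_of_cert_of_delta _ (by norm_num [Δ, b₂, b₄, b₆, b₈]) 3604 147200 5
    (by simp only [Ψ₃, eval_add, eval_mul, eval_pow, eval_C, eval_X, eval_ofNat]; norm_num [b₂, b₄, b₆, b₈])
    (X2.CellACertN9.squarefree_of_nodup_primeFactorsList_natAbs (by norm_num) (by simp [Nat.primeFactorsList_ofNat])) (by norm_num)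
    (by rw [KernelDisc.eval_Ψ₂Sq]; norm_num [b₂, b₄, b₆]) (by decide) (by decide) (by decide)

/-- `135360dt2` = `[0,0,0,-3656172,-1840627024]` (class `135360dt`, (G-ord, `e = 2`) at `3`; twist `15040b2`, `a₃(V) = -1`, non-anomalous; even line
`φ = χ_{2}`): `x₀ = 3174`, `D = 2`, `s = 192512`, `Ψ₂Sq(x₀) = 74121740288` ⇒ `X3LineDatumThree W`. [folklore] -/
theorem x3LineDatumThree_135360dt2 : X3LineDatumThree (⟨0, 0, 0, -3656172, -1840627024⟩ : WeierstrassCurve ℚ) :=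
  x3LineDatumThree_of_cert_of_delta _ (by norm_num [Δ, b₂, b₄, b₆, b₈]) 3174 192512 2
    (by simp only [Ψ₃, eval_add, eval_mul, eval_pow, eval_C, eval_X, eval_ofNat]; norm_num [b₂, b₄, b₆, b₈])
    Int.prime_two.squarefree (by norm_num)
    (by rw [KernelDisc.eval_Ψ₂Sq]; norm_num [b₂, b₄, b₆]) (by decide) (by decide) (by decide)

/-- `135360ex2` = `[0,0,0,-1134588,420381488]` (class `135360ex`, (G-ord, `e = 2`) at `3`; twist `15040s2`, `a₃(V) = -1`, non-anomalous; even line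
`φ = χ_{2}`): `x₀ = 1014`, `D = 2`, `s = 25000`, `Ψ₂Sq(x₀) = 1250000000` ⇒ `X3LineDatumThree W`. [folklore] -/
theorem x3LineDatumThree_135360ex2 : X3LineDatumThree (⟨0, 0, 0, -1134588, 420381488⟩ : WeierstrassCurve ℚ) :=
  x3LineDatumThree_of_cert_of_delta _ (by norm_num [Δ, b₂, b₄, b₆, b₈]) 1014 25000 2
    (by simp only [Ψ₃, eval_add, eval_mul, eval_pow, eval_C, eval_X, eval_ofNat]; norm_num [b₂, b₄, b₆, b₈])
    Int.prime_two.squarefree (by norm_num)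
    (by rw [KernelDisc.eval_Ψ₂Sq]; norm_num [b₂, b₄, b₆]) (by decide) (by decide) (by decide)

/-- `135450ek2` = `[1,-1,0,-19895551992,-1820769442683584]` (class `135450ek`, (G-ord, `e = 2`) at `3`; twist `15050o2`, `a₃(V) = -1`, non-anomalous; even line
`φ = χ_{5}`): `x₀ = 263344`, `D = 5`, `s = 94668800`, `Ψ₂Sq(x₀) = 44810908467200000` ⇒ `X3LineDatumThree W`. [folklore] -/
theorem x3LineDatumThree_135450ek2 : X3LineDatumThree (⟨1, -1, 0, -19895551992, -1820769442683584⟩ : WeierstrassCurve ℚ) :=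
  x3LineDatumThree_of_cert_of_delta _ (by norm_num [Δ, b₂, b₄, b₆, b₈]) 263344 94668800 5
    (by simp only [Ψ₃, eval_add, eval_mul, eval_pow, eval_C, eval_X, eval_ofNat]; norm_num [b₂, b₄, b₆, b₈])
    (X2.CellACertN9.squarefree_of_nodup_primeFactorsList_natAbs (by norm_num) (by simp [Nat.primeFactorsList_ofNat])) (by norm_num)
    (by rw [KernelDisc.eval_Ψ₂Sq]; norm_num [b₂, b₄, b₆]) (by decide) (by decide) (by decide)

/-- `135531l2` = `[0,0,1,-37074,2747592]` (class `135531l`, (G-ord, `e = 2`) at `3`; twist `15059c2`, `a₃(V) = 1` — ANOMALOUS (outside the end state as typed); even line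
`φ = χ_{37}`): `x₀ = 111`, `D = 37`, `s = 1`, `Ψ₂Sq(x₀) = 37` ⇒ `X3LineDatumThree W`. [folklore] -/
theorem x3LineDatumThree_135531l2 : X3LineDatumThree (⟨0, 0, 1, -37074, 2747592⟩ : WeierstrassCurve ℚ) :=
  x3LineDatumThree_of_cert_of_delta _ (by norm_num [Δ, b₂, b₄, b₆, b₈]) 111 1 37
    (by simp only [Ψ₃, eval_add, eval_mul, eval_pow, eval_C, eval_X, eval_ofNat]; norm_num [b₂, b₄, b₆, b₈])
    (X2.CellACertN9.squarefree_of_nodup_primeFactorsList_natAbs (by norm_num) (by simp [Nat.primeFactorsList_ofNat])) (by norm_num)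
    (by rw [KernelDisc.eval_Ψ₂Sq]; norm_num [b₂, b₄, b₆]) (by decide) (by decide) (by decide)

/-- `135900r2` = `[0,0,0,79800,6396500]` (class `135900r`, (G-ord, `e = 2`) at `3`; twist `15100c2`, `a₃(V) = -1`, non-anomalous; even line
`φ = χ_{5}`): `x₀ = 60`, `D = 5`, `s = 3020`, `Ψ₂Sq(x₀) = 45602000` ⇒ `X3LineDatumThree W`. [folklore] -/
theorem x3LineDatumThree_135900r2 : X3LineDatumThree (⟨0, 0, 0, 79800, 6396500⟩ : WeierstrassCurve ℚ) :=
  x3LineDatumThree_of_cert_of_delta _ (by norm_num [Δ, b₂, b₄, b₆, b₈]) 60 3020 5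
    (by simp only [Ψ₃, eval_add, eval_mul, eval_pow, eval_C, eval_X, eval_ofNat]; norm_num [b₂, b₄, b₆, b₈])
    (X2.CellACertN9.squarefree_of_nodup_primeFactorsList_natAbs (by norm_num) (by simp [Nat.primeFactorsList_ofNat])) (by norm_num)
    (by rw [KernelDisc.eval_Ψ₂Sq]; norm_num [b₂, b₄, b₆]) (by decide) (by decide) (by decide)

/-- `137475l2` = `[0,0,1,-40260,1938001]` (class `137475l`, (G-ord, `e = 2`) at `3`; twist `15275b2`, `a₃(V) = -1`, non-anomalous; even line
`φ = χ_{5}`): `x₀ = 240`, `D = 5`, `s = 2209`, `Ψ₂Sq(x₀) = 24398405` ⇒ `X3LineDatumThree W`. [folklore] -/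
theorem x3LineDatumThree_137475l2 : X3LineDatumThree (⟨0, 0, 1, -40260, 1938001⟩ : WeierstrassCurve ℚ) :=
  x3LineDatumThree_of_cert_of_delta _ (by norm_num [Δ, b₂, b₄, b₆, b₈]) 240 2209 5
    (by simp only [Ψ₃, eval_add, eval_mul, eval_pow, eval_C, eval_X, eval_ofNat]; norm_num [b₂, b₄, b₆, b₈])
    (X2.CellACertN9.squarefree_of_nodup_primeFactorsList_natAbs (by norm_num) (by simp [Nat.primeFactorsList_ofNat])) (by norm_num)
    (by rw [KernelDisc.eval_Ψ₂Sq]; norm_num [b₂, b₄, b₆]) (by decide) (by decide) (by decide)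

/-- `137475m2` = `[0,0,1,-102450,17597281]` (class `137475m`, (G-ord, `e = 2`) at `3`; twist `15275c2`, `a₃(V) = -1`, non-anomalous; even line
`φ = χ_{5}`): `x₀ = 60`, `D = 5`, `s = 3055`, `Ψ₂Sq(x₀) = 46665125` ⇒ `X3LineDatumThree W`. [folklore] -/
theorem x3LineDatumThree_137475m2 : X3LineDatumThree (⟨0, 0, 1, -102450, 17597281⟩ : WeierstrassCurve ℚ) :=
  x3LineDatumThree_of_cert_of_delta _ (by norm_num [Δ, b₂, b₄, b₆, b₈]) 60 3055 5
    (by simp only [Ψ₃, eval_add, eval_mul, eval_pow, eval_C, eval_X, eval_ofNat]; norm_num [b₂, b₄, b₆, b₈])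
    (X2.CellACertN9.squarefree_of_nodup_primeFactorsList_natAbs (by norm_num) (by simp [Nat.primeFactorsList_ofNat])) (by norm_num)
    (by rw [KernelDisc.eval_Ψ₂Sq]; norm_num [b₂, b₄, b₆]) (by decide) (by decide) (by decide)

/-- `138384u2` = `[0,0,0,-22971,1339882]` (class `138384u`, (G-ord, `e = 2`) at `3`; twist `15376v2`, `a₃(V) = 1` — ANOMALOUS (outside the end state as typed); even line
`φ = χ_{31}`): `x₀ = 93`, `D = 31`, `s = 32`, `Ψ₂Sq(x₀) = 31744` ⇒ `X3LineDatumThree W`. [folklore] -/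
theorem x3LineDatumThree_138384u2 : X3LineDatumThree (⟨0, 0, 0, -22971, 1339882⟩ : WeierstrassCurve ℚ) :=
  x3LineDatumThree_of_cert_of_delta _ (by norm_num [Δ, b₂, b₄, b₆, b₈]) 93 32 31
    (by simp only [Ψ₃, eval_add, eval_mul, eval_pow, eval_C, eval_X, eval_ofNat]; norm_num [b₂, b₄, b₆, b₈])
    (X2.CellACertN9.squarefree_of_nodup_primeFactorsList_natAbs (by norm_num) (by simp [Nat.primeFactorsList_ofNat])) (by norm_num)
    (by rw [KernelDisc.eval_Ψ₂Sq]; norm_num [b₂, b₄, b₆]) (by decide) (by decide) (by decide)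

/-- `138384w2` = `[0,0,0,152799,13614487]` (class `138384w`, (G-ord, `e = 2`) at `3`; twist `15376y2`, `a₃(V) = -2` — ANOMALOUS (outside the end state as typed); even line
`φ = χ_{31}`): `x₀ = 93`, `D = 31`, `s = 1922`, `Ψ₂Sq(x₀) = 114516604` ⇒ `X3LineDatumThree W`. [folklore] -/
theorem x3LineDatumThree_138384w2 : X3LineDatumThree (⟨0, 0, 0, 152799, 13614487⟩ : WeierstrassCurve ℚ) :=
  x3LineDatumThree_of_cert_of_delta _ (by norm_num [Δ, b₂, b₄, b₆, b₈]) 93 1922 31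
    (by simp only [Ψ₃, eval_add, eval_mul, eval_pow, eval_C, eval_X, eval_ofNat]; norm_num [b₂, b₄, b₆, b₈])
    (X2.CellACertN9.squarefree_of_nodup_primeFactorsList_natAbs (by norm_num) (by simp [Nat.primeFactorsList_ofNat])) (by norm_num)
    (by rw [KernelDisc.eval_Ψ₂Sq]; norm_num [b₂, b₄, b₆]) (by decide) (by decide) (by decide)

/-- `139932l2` = `[0,0,0,-27885,2190409]` (class `139932l`, (G-ord, `e = 2`) at `3`; twist `15548a2`, `a₃(V) = 1` — ANOMALOUS (outside the end state as typed); even line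
`φ = χ_{13}`): `x₀ = 39`, `D = 13`, `s = 598`, `Ψ₂Sq(x₀) = 4648852` ⇒ `X3LineDatumThree W`. [folklore] -/
theorem x3LineDatumThree_139932l2 : X3LineDatumThree (⟨0, 0, 0, -27885, 2190409⟩ : WeierstrassCurve ℚ) :=
  x3LineDatumThree_of_cert_of_delta _ (by norm_num [Δ, b₂, b₄, b₆, b₈]) 39 598 13
    (by simp only [Ψ₃, eval_add, eval_mul, eval_pow, eval_C, eval_X, eval_ofNat]; norm_num [b₂, b₄, b₆, b₈])
    (X2.CellACertN9.squarefree_of_nodup_primeFactorsList_natAbs (by norm_num) (by simp [Nat.primeFactorsList_ofNat])) (by norm_num)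
    (by rw [KernelDisc.eval_Ψ₂Sq]; norm_num [b₂, b₄, b₆]) (by decide) (by decide) (by decide)

/-- `140850br2` = `[1,-1,0,-12634317,17760938341]` (class `140850br`, (G-ord, `e = 2`) at `3`; twist `15650k2`, `a₃(V) = -1`, non-anomalous; even line
`φ = χ_{5}`): `x₀ = 1354`, `D = 5`, `s = 50080`, `Ψ₂Sq(x₀) = 12540032000` ⇒ `X3LineDatumThree W`. [folklore] -/
theorem x3LineDatumThree_140850br2 : X3LineDatumThree (⟨1, -1, 0, -12634317, 17760938341⟩ : WeierstrassCurve ℚ) :=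
  x3LineDatumThree_of_cert_of_delta _ (by norm_num [Δ, b₂, b₄, b₆, b₈]) 1354 50080 5
    (by simp only [Ψ₃, eval_add, eval_mul, eval_pow, eval_C, eval_X, eval_ofNat]; norm_num [b₂, b₄, b₆, b₈])
    (X2.CellACertN9.squarefree_of_nodup_primeFactorsList_natAbs (by norm_num) (by simp [Nat.primeFactorsList_ofNat])) (by norm_num)
    (by rw [KernelDisc.eval_Ψ₂Sq]; norm_num [b₂, b₄, b₆]) (by decide) (by decide) (by decide)

/-- `141120dh2` = `[0,0,0,-91308,18440912]` (class `141120dh`, (G-ord, `e = 2`) at `3`; twist `15680dr2`, `a₃(V) = 2`, non-anomalous; even line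
`φ = χ_{14}`): `x₀ = 42`, `D = 14`, `s = 2048`, `Ψ₂Sq(x₀) = 58720256` ⇒ `X3LineDatumThree W`. [folklore] -/
theorem x3LineDatumThree_141120dh2 : X3LineDatumThree (⟨0, 0, 0, -91308, 18440912⟩ : WeierstrassCurve ℚ) :=
  x3LineDatumThree_of_cert_of_delta _ (by norm_num [Δ, b₂, b₄, b₆, b₈]) 42 2048 14
    (by simp only [Ψ₃, eval_add, eval_mul, eval_pow, eval_C, eval_X, eval_ofNat]; norm_num [b₂, b₄, b₆, b₈])
    (X2.CellACertN9.squarefree_of_nodup_primeFactorsList_natAbs (by norm_num) (by simp [Nat.primeFactorsList_ofNat])) (by norm_num)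
    (by rw [KernelDisc.eval_Ψ₂Sq]; norm_num [b₂, b₄, b₆]) (by decide) (by decide) (by decide)

/-- `141120di2` = `[0,0,0,-1420608,651721952]` (class `141120di`, (G-ord, `e = 2`) at `3`; twist `15680dp2`, `a₃(V) = -1`, non-anomalous; even line
`φ = χ_{14}`): `x₀ = 672`, `D = 14`, `s = 392`, `Ψ₂Sq(x₀) = 2151296` ⇒ `X3LineDatumThree W`. [folklore] -/
theorem x3LineDatumThree_141120di2 : X3LineDatumThree (⟨0, 0, 0, -1420608, 651721952⟩ : WeierstrassCurve ℚ) :=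
  x3LineDatumThree_of_cert_of_delta _ (by norm_num [Δ, b₂, b₄, b₆, b₈]) 672 392 14
    (by simp only [Ψ₃, eval_add, eval_mul, eval_pow, eval_C, eval_X, eval_ofNat]; norm_num [b₂, b₄, b₆, b₈])
    (X2.CellACertN9.squarefree_of_nodup_primeFactorsList_natAbs (by norm_num) (by simp [Nat.primeFactorsList_ofNat])) (by norm_num)
    (by rw [KernelDisc.eval_Ψ₂Sq]; norm_num [b₂, b₄, b₆]) (by decide) (by decide) (by decide)

/-- `141120nb2` = `[0,0,0,-917868,367372208]` (class `141120nb`, (G-ord, `e = 2`) at `3`; twist `15680bg2`, `a₃(V) = -1`, non-anomalous; even line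
`φ = χ_{2}`): `x₀ = 294`, `D = 2`, `s = 15680`, `Ψ₂Sq(x₀) = 491724800` ⇒ `X3LineDatumThree W`. [folklore] -/
theorem x3LineDatumThree_141120nb2 : X3LineDatumThree (⟨0, 0, 0, -917868, 367372208⟩ : WeierstrassCurve ℚ) :=
  x3LineDatumThree_of_cert_of_delta _ (by norm_num [Δ, b₂, b₄, b₆, b₈]) 294 15680 2
    (by simp only [Ψ₃, eval_add, eval_mul, eval_pow, eval_C, eval_X, eval_ofNat]; norm_num [b₂, b₄, b₆, b₈])
    Int.prime_two.squarefree (by norm_num)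
    (by rw [KernelDisc.eval_Ψ₂Sq]; norm_num [b₂, b₄, b₆]) (by decide) (by decide) (by decide)

/-- `141120nr2` = `[0,0,0,34692,-11111632]` (class `141120nr`, (G-ord, `e = 2`) at `3`; twist `15680bh2`, `a₃(V) = -1`, non-anomalous; even line
`φ = χ_{2}`): `x₀ = 294`, `D = 2`, `s = 7000`, `Ψ₂Sq(x₀) = 98000000` ⇒ `X3LineDatumThree W`. [folklore] -/
theorem x3LineDatumThree_141120nr2 : X3LineDatumThree (⟨0, 0, 0, 34692, -11111632⟩ : WeierstrassCurve ℚ) :=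
  x3LineDatumThree_of_cert_of_delta _ (by norm_num [Δ, b₂, b₄, b₆, b₈]) 294 7000 2
    (by simp only [Ψ₃, eval_add, eval_mul, eval_pow, eval_C, eval_X, eval_ofNat]; norm_num [b₂, b₄, b₆, b₈])
    Int.prime_two.squarefree (by norm_num)
    (by rw [KernelDisc.eval_Ψ₂Sq]; norm_num [b₂, b₄, b₆]) (by decide) (by decide) (by decide)

/-- `142272en2` = `[0,0,0,-69060,6985352]` (class `142272en`, (G-ord, `e = 2`) at `3`; twist `15808a2`, `a₃(V) = 2`, non-anomalous; even line
`φ = χ_{2}`): `x₀ = 150`, `D = 2`, `s = 52`, `Ψ₂Sq(x₀) = 5408` ⇒ `X3LineDatumThree W`. [folklore] -/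
theorem x3LineDatumThree_142272en2 : X3LineDatumThree (⟨0, 0, 0, -69060, 6985352⟩ : WeierstrassCurve ℚ) :=
  x3LineDatumThree_of_cert_of_delta _ (by norm_num [Δ, b₂, b₄, b₆, b₈]) 150 52 2
    (by simp only [Ψ₃, eval_add, eval_mul, eval_pow, eval_C, eval_X, eval_ofNat]; norm_num [b₂, b₄, b₆, b₈])
    Int.prime_two.squarefree (by norm_num)
    (by rw [KernelDisc.eval_Ψ₂Sq]; norm_num [b₂, b₄, b₆]) (by decide) (by decide) (by decide)

/-- `142578h2` = `[1,-1,0,-39495591,95596246093]` (class `142578h`, (G-ord, `e = 2`) at `3`; twist `15842b2`, `a₃(V) = -1`, non-anomalous; even line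
`φ = χ_{89}`): `x₀ = 3271`, `D = 89`, `s = 7921`, `Ψ₂Sq(x₀) = 5584059449` ⇒ `X3LineDatumThree W`. [folklore] -/
theorem x3LineDatumThree_142578h2 : X3LineDatumThree (⟨1, -1, 0, -39495591, 95596246093⟩ : WeierstrassCurve ℚ) :=
  x3LineDatumThree_of_cert_of_delta _ (by norm_num [Δ, b₂, b₄, b₆, b₈]) 3271 7921 89
    (by simp only [Ψ₃, eval_add, eval_mul, eval_pow, eval_C, eval_X, eval_ofNat]; norm_num [b₂, b₄, b₆, b₈])
    (X2.CellACertN9.squarefree_of_nodup_primeFactorsList_natAbs (by norm_num) (by simp [Nat.primeFactorsList_ofNat])) (by norm_num)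
    (by rw [KernelDisc.eval_Ψ₂Sq]; norm_num [b₂, b₄, b₆]) (by decide) (by decide) (by decide)

/-- `145575m2` = `[0,0,1,21300,-5854469]` (class `145575m`, (G-ord, `e = 2`) at `3`; twist `16175c2`, `a₃(V) = 2`, non-anomalous; even line
`φ = χ_{5}`): `x₀ = 240`, `D = 5`, `s = 3235`, `Ψ₂Sq(x₀) = 52326125` ⇒ `X3LineDatumThree W`. [folklore] -/
theorem x3LineDatumThree_145575m2 : X3LineDatumThree (⟨0, 0, 1, 21300, -5854469⟩ : WeierstrassCurve ℚ) :=
  x3LineDatumThree_of_cert_of_delta _ (by norm_num [Δ, b₂, b₄, b₆, b₈]) 240 3235 5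
    (by simp only [Ψ₃, eval_add, eval_mul, eval_pow, eval_C, eval_X, eval_ofNat]; norm_num [b₂, b₄, b₆, b₈])
    (X2.CellACertN9.squarefree_of_nodup_primeFactorsList_natAbs (by norm_num) (by simp [Nat.primeFactorsList_ofNat])) (by norm_num)
    (by rw [KernelDisc.eval_Ψ₂Sq]; norm_num [b₂, b₄, b₆]) (by decide) (by decide) (by decide)

/-- `145728fi2` = `[0,0,0,-82020,9045128]` (class `145728fi`, (G-ord, `e = 2`) at `3`; twist `16192l2`, `a₃(V) = -1`, non-anomalous; even line
`φ = χ_{2}`): `x₀ = 150`, `D = 2`, `s = 484`, `Ψ₂Sq(x₀) = 468512` ⇒ `X3LineDatumThree W`. [folklore] -/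
theorem x3LineDatumThree_145728fi2 : X3LineDatumThree (⟨0, 0, 0, -82020, 9045128⟩ : WeierstrassCurve ℚ) :=
  x3LineDatumThree_of_cert_of_delta _ (by norm_num [Δ, b₂, b₄, b₆, b₈]) 150 484 2
    (by simp only [Ψ₃, eval_add, eval_mul, eval_pow, eval_C, eval_X, eval_ofNat]; norm_num [b₂, b₄, b₆, b₈])
    Int.prime_two.squarefree (by norm_num)
    (by rw [KernelDisc.eval_Ψ₂Sq]; norm_num [b₂, b₄, b₆]) (by decide) (by decide) (by decide)

/-- `145728gd2` = `[0,0,0,-228396,42007088]` (class `145728gd`, (G-ord, `e = 2`) at `3`; twist `16192c2`, `a₃(V) = 2`, non-anomalous; even line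
`φ = χ_{2}`): `x₀ = 294`, `D = 2`, `s = 736`, `Ψ₂Sq(x₀) = 1083392` ⇒ `X3LineDatumThree W`. [folklore] -/
theorem x3LineDatumThree_145728gd2 : X3LineDatumThree (⟨0, 0, 0, -228396, 42007088⟩ : WeierstrassCurve ℚ) :=
  x3LineDatumThree_of_cert_of_delta _ (by norm_num [Δ, b₂, b₄, b₆, b₈]) 294 736 2
    (by simp only [Ψ₃, eval_add, eval_mul, eval_pow, eval_C, eval_X, eval_ofNat]; norm_num [b₂, b₄, b₆, b₈])
    Int.prime_two.squarefree (by norm_num)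
    (by rw [KernelDisc.eval_Ψ₂Sq]; norm_num [b₂, b₄, b₆]) (by decide) (by decide) (by decide)

/-- `148050bf2` = `[1,-1,1,768910,-89413383]` (class `148050bf`, (G-ord, `e = 2`) at `3`; twist `16450a2`, `a₃(V) = 2`, non-anomalous; even line
`φ = χ_{5}`): `x₀ = 454`, `D = 5`, `s = 16807`, `Ψ₂Sq(x₀) = 1412376245` ⇒ `X3LineDatumThree W`. [folklore] -/
theorem x3LineDatumThree_148050bf2 : X3LineDatumThree (⟨1, -1, 1, 768910, -89413383⟩ : WeierstrassCurve ℚ) :=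
  x3LineDatumThree_of_cert_of_delta _ (by norm_num [Δ, b₂, b₄, b₆, b₈]) 454 16807 5
    (by simp only [Ψ₃, eval_add, eval_mul, eval_pow, eval_C, eval_X, eval_ofNat]; norm_num [b₂, b₄, b₆, b₈])
    (X2.CellACertN9.squarefree_of_nodup_primeFactorsList_natAbs (by norm_num) (by simp [Nat.primeFactorsList_ofNat])) (by norm_num)
    (by rw [KernelDisc.eval_Ψ₂Sq]; norm_num [b₂, b₄, b₆]) (by decide) (by decide) (by decide)

/-- `148050dc2` = `[1,-1,0,-7092,1132816]` (class `148050dc`, (G-ord, `e = 2`) at `3`; twist `16450j2`, `a₃(V) = -1`, non-anomalous; even line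
`φ = χ_{5}`): `x₀ = 4`, `D = 5`, `s = 940`, `Ψ₂Sq(x₀) = 4418000` ⇒ `X3LineDatumThree W`. [folklore] -/
theorem x3LineDatumThree_148050dc2 : X3LineDatumThree (⟨1, -1, 0, -7092, 1132816⟩ : WeierstrassCurve ℚ) :=
  x3LineDatumThree_of_cert_of_delta _ (by norm_num [Δ, b₂, b₄, b₆, b₈]) 4 940 5
    (by simp only [Ψ₃, eval_add, eval_mul, eval_pow, eval_C, eval_X, eval_ofNat]; norm_num [b₂, b₄, b₆, b₈])
    (X2.CellACertN9.squarefree_of_nodup_primeFactorsList_natAbs (by norm_num) (by simp [Nat.primeFactorsList_ofNat])) (by norm_num)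
    (by rw [KernelDisc.eval_Ψ₂Sq]; norm_num [b₂, b₄, b₆]) (by decide) (by decide) (by decide)

/-- `148050dh3` = `[1,-1,0,-3403692,2417827216]` (class `148050dh`, (G-ord, `e = 2`) at `3`; twist `16450k3`, `a₃(V) = 2`, non-anomalous; even line
`φ = χ_{5}`): `x₀ = 1084`, `D = 5`, `s = 940`, `Ψ₂Sq(x₀) = 4418000` ⇒ `X3LineDatumThree W`. [folklore] -/
theorem x3LineDatumThree_148050dh3 : X3LineDatumThree (⟨1, -1, 0, -3403692, 2417827216⟩ : WeierstrassCurve ℚ) :=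
  x3LineDatumThree_of_cert_of_delta _ (by norm_num [Δ, b₂, b₄, b₆, b₈]) 1084 940 5
    (by simp only [Ψ₃, eval_add, eval_mul, eval_pow, eval_C, eval_X, eval_ofNat]; norm_num [b₂, b₄, b₆, b₈])
    (X2.CellACertN9.squarefree_of_nodup_primeFactorsList_natAbs (by norm_num) (by simp [Nat.primeFactorsList_ofNat])) (by norm_num)
    (by rw [KernelDisc.eval_Ψ₂Sq]; norm_num [b₂, b₄, b₆]) (by decide) (by decide) (by decide)

/-- `148950s2` = `[1,-1,1,-18031055,29475783447]` (class `148950s`, (G-ord, `e = 2`) at `3`; twist `16550c2`, `a₃(V) = -1`, non-anomalous; even line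
`φ = χ_{5}`): `x₀ = 2344`, `D = 5`, `s = 8275`, `Ψ₂Sq(x₀) = 342378125` ⇒ `X3LineDatumThree W`. [folklore] -/
theorem x3LineDatumThree_148950s2 : X3LineDatumThree (⟨1, -1, 1, -18031055, 29475783447⟩ : WeierstrassCurve ℚ) :=
  x3LineDatumThree_of_cert_of_delta _ (by norm_num [Δ, b₂, b₄, b₆, b₈]) 2344 8275 5
    (by simp only [Ψ₃, eval_add, eval_mul, eval_pow, eval_C, eval_X, eval_ofNat]; norm_num [b₂, b₄, b₆, b₈])
    (X2.CellACertN9.squarefree_of_nodup_primeFactorsList_natAbs (by norm_num) (by simp [Nat.primeFactorsList_ofNat])) (by norm_num)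
    (by rw [KernelDisc.eval_Ψ₂Sq]; norm_num [b₂, b₄, b₆]) (by decide) (by decide) (by decide)

/-- `149058eu2` = `[1,-1,0,-256671,45606861]` (class `149058eu`, (G-ord, `e = 2`) at `3`; twist `16562bb2`, `a₃(V) = 1` — ANOMALOUS (outside the end state as typed); even line
`φ = χ_{13}`): `x₀ = 478`, `D = 13`, `s = 3136`, `Ψ₂Sq(x₀) = 127848448` ⇒ `X3LineDatumThree W`. [folklore] -/
theorem x3LineDatumThree_149058eu2 : X3LineDatumThree (⟨1, -1, 0, -256671, 45606861⟩ : WeierstrassCurve ℚ) :=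
  x3LineDatumThree_of_cert_of_delta _ (by norm_num [Δ, b₂, b₄, b₆, b₈]) 478 3136 13
    (by simp only [Ψ₃, eval_add, eval_mul, eval_pow, eval_C, eval_X, eval_ofNat]; norm_num [b₂, b₄, b₆, b₈])
    (X2.CellACertN9.squarefree_of_nodup_primeFactorsList_natAbs (by norm_num) (by simp [Nat.primeFactorsList_ofNat])) (by norm_num)
    (by rw [KernelDisc.eval_Ψ₂Sq]; norm_num [b₂, b₄, b₆]) (by decide) (by decide) (by decide)

end Summit.BirchSwinnertonDyer.Rank1Residual.Additive.X3ThreeLineDatumRecords
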